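import Summits.ABC.IUTFork.Cor312GenuineKWildLowerBound
import Literature.IUT.LogVolume.GenuineThetaFieldCyclotomicRamification
import HarnessLib

/-!
# [IUTchIII] Cor. 3.12, branch C / R-W window table — the CYCLOTOMIC lower local type at the `K`-level pilot datum over
# the wild primes `p ∈ {3, 5}` (`p ∣ 30`): `(p − 1) ∣ e(K_{x₀}/ℚ_p)`, and with the Tate root `30·l ∣ e·t` at `3`, `60·l ∣ e·t` at `5`

PROOF-ONLY support file (D-0012; 0 definitions, 0 `Prop` facts) of the abc-iut cell (R-W «WINDOW Θ-SIDE INEQUALITY», seat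
abc-iut-W-neg-2 gen 2, row «W:LOCAL-TYPE-LB-FIBRE»; fibre form of abc-iut-W-neg-1's Stage (S6) of GAP G-Wnum2-1). TAKES NO
SIDE on [IUTchIII] Cor. 3.12 (S. Mochizuki, *Inter-universal Teichmüller theory III*, RIMS manuscript, Cor. 3.12 p. 173–174)
or on any author.

The INHABITED-side consumers of the R-W window table (abc-iut-W-row-1/2, the U2 licence wrapper; the numerics lead's route
census HOME/plan/rescue/R-W/OPEN-INHABITED-ROUTE.tsv, input «LBz») need, at the wild primes `p ∈ {3, 5}`, the LOWER bound
`(p − 1) ∣ e(K_{x₀}/ℚ_p)` at EVERY fibre point `x₀ ∣ p` of the pilot datum `pilotDataOfK T.D T.K` of a genuine Θ-volume datum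
`T`. At the `F`-layer this is abc-iut-W-neg-1's `Cor22.ThetaVolumeDatumAt.sub_one_dvd_ramificationIdx_int` (p469119: the
`30`-torsion of `E_F` is `F`-rational, so `μ₃₀ ⊂ F` by the Weil pairing — a theorem in the tree,
`WeierstrassCurve.exists_isPrimitiveRoot_of_card_torsionBy_eq_sq_holds` — and `p` is totally ramified in `ℚ(ζ_p)`);
this file reads it at the fibre points through the tower `ℤ ⊆ 𝓞_F ⊆ 𝓞_K` (`ThetaData.absRamificationIdx_eq_ramIdx_mul`)
and combines it with the landed `l ∣ e` / `15·l ∣ e·t` of `Cor312GenuineKWildLowerBound` (p467688):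

* `Conditional.GenuineK.sub_one_dvd_absRamificationIdx_kOf` — `p ∣ 30` prime, EVERY `x₀ ∣ p`: **`(p − 1) ∣ e(K_{x₀}/ℚ_p)`**
  (`2 ∣ e` over `3`, `4 ∣ e` over `5`; no pole hypothesis, any base point `P`);
* `Conditional.GenuineK.sub_one_mul_prime_dvd_absRamificationIdx_kOf_ratPoint` — at a rational pole of `j`, `p ∣ 30`,
  `p ∉ {2, l}`: **`(p − 1)·l ∣ e(K_{x₀}/ℚ_p)`**;
* `Conditional.GenuineK.thirty_mul_prime_dvd_absRamificationIdx_kOf_mul_three` /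
  `…sixty_mul_prime_dvd_absRamificationIdx_kOf_mul_five` — at a rational pole of order `2t` (`ord_p j(q) = −2t`):
  **`30·l ∣ e(K_{x₀}/ℚ_3)·t`**, **`60·l ∣ e(K_{x₀}/ℚ_5)·t`** (the numerics lead's level-2 wild bound
  `lcm(15/gcd(15,t), p−1)·l ∣ e`), and the generic case `gcd(15, t) = 1`: `30·l ∣ e` over `3`, `60·l ∣ e` over `5`
  (`…_of_coprime`).

NOT in this file (and NOT a theorem about the typed datum): the «twist factor `2`» at a tame pole of `λ` of odd order —
`Cor22.ThetaVolumeDatumAt` pins `E_F` only through `j(E_F) = j(λ)`, so quadratic twists of the Legendre model are admitted.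
HONEST FRAMING: bookkeeping over OUR typed objects; nothing here bears on the printed inequality of [IUTchIII] Cor. 3.12 or
on the number-level `Cor22.Cor312AtDatum`; typed ≠ proved; instantiated ≠ endorsed.
[cite: Mochizuki2012, IUTchI Ex. 3.2 (iv) p. 71; IUTchIV Thm. 1.10 p. 22, Cor. 2.2 (ii) proof (P5) p. 46]
[cite: Washington1997, Lemma 1.4 and Prop. 2.1] [cite: SilvermanATAEC1994, V.5 Thm. 5.3 and Cor. 5.4]
[claim: Mochizuki2012, status: disputed] for every IUT quotation.
-/

noncomputable section

open NumberField IsDedekindDomain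

namespace Summit.ABC.IUTFork.Conditional

open Thm311 Thm311.Real Cor312 Cor312Prov Literature.IUT.LogVolume Literature.IUT.HodgeTheaters
  Literature.IUT.LogThetaLattice Literature.NumberTheory.NumberFields Literature.NumberTheory.DiophantineGeometry.GenEll
  Literature.NumberTheory.DiophantineGeometry

/-- **`(p − 1) ∣ e(K_{x₀}/ℚ_p)` at EVERY fibre point `x₀ ∣ p` of the `K`-level pilot datum, for a prime `p ∣ 30`** (`2 ∣ e`
over `3`, `4 ∣ e` over `5`): `ζ_p ∈ F` (Weil pairing on the `F`-rational `30`-torsion, abc-iut-W-neg-1's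
`ThetaVolumeDatumAt.sub_one_dvd_ramificationIdx_int`) gives `(p−1) ∣ e(w | p)` for the place `w` of `F` under `x₀`, and
`e(K_{x₀}/ℚ_p) = e(w | p)·e(x₀ | w)`. No pole hypothesis; any base point.
[cite: Washington1997, Lemma 1.4 and Prop. 2.1] [cite: Mochizuki2012, IUTchIV Thm. 1.10 p. 22] [claim: Mochizuki2012, status: disputed] -/
theorem GenuineK.sub_one_dvd_absRamificationIdx_kOf {P : NFPoint} {l : ℕ} (T : Cor22.ThetaVolumeDatumAt P l)
    (pp : Nat.Primes) (hp30 : (pp : ℕ) ∣ 30) :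
    letI := T.instFieldF; letI := T.instNumberFieldF; letI := T.instAlgebraF; letI := T.instFieldK
    letI := T.instNumberFieldK; letI := T.instAlgebraK; letI := T.instFieldFbar; letI := T.instAlgebraFbar
    letI := T.instAlgebraKFbar; letI := T.instIsElliptic
    haveI : Fact (pp : ℕ).Prime := ⟨pp.2⟩
    ∀ x₀ : (thetaIndex (pilotDataOfK T.D T.K)).Fibre (.inr pp),
      ((pp : ℕ) - 1) ∣ absRamificationIdx (pp : ℕ) (kOf (pilotDataOfK T.D T.K) pp.1 x₀) := by
  letI := T.instFieldF; letI := T.instNumberFieldF; letI := T.instAlgebraF; letI := T.instFieldK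
  letI := T.instNumberFieldK; letI := T.instAlgebraK; letI := T.instFieldFbar; letI := T.instAlgebraFbar
  letI := T.instAlgebraKFbar; letI := T.instIsElliptic
  haveI : Fact (pp : ℕ).Prime := ⟨pp.2⟩
  set X := pilotDataOfK T.D T.K with hXdef
  intro x₀
  set u := placeOf X pp.1 x₀ with hudef
  have hpu : ((pp : ℕ) : 𝓞 T.K) ∈ u.asIdeal := natCast_mem_placeOf X pp.1 x₀
  have hekOf : absRamificationIdx (pp : ℕ) (kOf X pp.1 x₀) = u.asIdeal.ramificationIdx ℤ := by
    rw [show absRamificationIdx (pp : ℕ) (kOf X pp.1 x₀) =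
        absRamificationIdx (pp : ℕ) (RescaledCompletion T.K pp.1 (placeOf X pp.1 x₀) hpu) from rfl,
      absRamificationIdx_rescaledCompletion]
  -- the place `w = u ∩ 𝓞_F` of `F` under `x₀` lies over `p`
  have hpw : ((pp : ℕ) : 𝓞 T.F) ∈ (finBelow T.F T.K u).asIdeal := by
    change ((pp : ℕ) : 𝓞 T.F) ∈ Ideal.comap (algebraMap (𝓞 T.F) (𝓞 T.K)) u.asIdeal
    rw [Ideal.mem_comap, map_natCast]
    exact hpu
  -- `(p − 1) ∣ e(w | p)` at the `F`-layer (`ζ_p ∈ F`)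
  have hF : ((pp : ℕ) - 1) ∣ (finBelow T.F T.K u).asIdeal.ramificationIdx ℤ :=
    T.sub_one_dvd_ramificationIdx_int pp.2 hp30 (finBelow T.F T.K u) hpw
  -- `e(u | p) = e(w | p) · e(u | w)`
  rw [hekOf, ThetaData.absRamificationIdx_eq_ramIdx_mul (F := T.F) u, ramIdx_eq]
  exact dvd_mul_of_dvd_left hF _

/-- **`(p − 1)·l ∣ e(K_{x₀}/ℚ_p)` at every fibre point over a rational pole of `j`, `p ∣ 30`, `p ∉ {2, l}`** (so `p ∈ {3,5}`:
`2·l ∣ e` over `3`, `4·l ∣ e` over `5`): the cyclotomic factor `p − 1` of `e(w | p)` (`ζ_p ∈ F`) times the exact factor `l`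
of the `l`-division layer (abc-iut-W-neg-1's `GenuineK.absRamificationIdx_kOf_eq_mul_prime_ratPoint`).
[cite: Washington1997, Prop. 2.1] [cite: Mochizuki2012, IUTchI Ex. 3.2 (iv) p. 71] [claim: Mochizuki2012, status: disputed] -/
theorem GenuineK.sub_one_mul_prime_dvd_absRamificationIdx_kOf_ratPoint {q : ℚ} {l : ℕ}
    (T : Cor22.ThetaVolumeDatumAt (ratPoint q) l) (pp : Nat.Primes) (hp30 : (pp : ℕ) ∣ 30) (hp2 : (pp : ℕ) ≠ 2)
    (hpl : (pp : ℕ) ≠ l)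
    (hpole : ∀ v : HeightOneSpectrum (𝓞 ℚ), Rat.HeightOneSpectrum.natGenerator v = pp →
      Literature.IUT.LogVolume.ord ℚ v (Cor22.jInv q) < 0) :
    letI := T.instFieldF; letI := T.instNumberFieldF; letI := T.instAlgebraF; letI := T.instFieldK
    letI := T.instNumberFieldK; letI := T.instAlgebraK; letI := T.instFieldFbar; letI := T.instAlgebraFbar
    letI := T.instAlgebraKFbar; letI := T.instIsElliptic
    haveI : Fact (pp : ℕ).Prime := ⟨pp.2⟩
    ∀ x₀ : (thetaIndex (pilotDataOfK T.D T.K)).Fibre (.inr pp),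
      ((pp : ℕ) - 1) * l ∣ absRamificationIdx (pp : ℕ) (kOf (pilotDataOfK T.D T.K) pp.1 x₀) := by
  letI := T.instFieldF; letI := T.instNumberFieldF; letI := T.instAlgebraF; letI := T.instFieldK
  letI := T.instNumberFieldK; letI := T.instAlgebraK; letI := T.instFieldFbar; letI := T.instAlgebraFbar
  letI := T.instAlgebraKFbar; letI := T.instIsElliptic
  haveI : Fact (pp : ℕ).Prime := ⟨pp.2⟩
  set X := pilotDataOfK T.D T.K with hXdef
  intro x₀
  rw [GenuineK.absRamificationIdx_kOf_eq_mul_prime_ratPoint T pp hp2 hpl hpole x₀]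
  set u := placeOf X pp.1 x₀ with hudef
  have hpu : ((pp : ℕ) : 𝓞 T.K) ∈ u.asIdeal := natCast_mem_placeOf X pp.1 x₀
  have hpw : ((pp : ℕ) : 𝓞 T.F) ∈ (finBelow T.F T.K u).asIdeal := by
    change ((pp : ℕ) : 𝓞 T.F) ∈ Ideal.comap (algebraMap (𝓞 T.F) (𝓞 T.K)) u.asIdeal
    rw [Ideal.mem_comap, map_natCast]
    exact hpu
  exact mul_dvd_mul (T.sub_one_dvd_ramificationIdx_int pp.2 hp30 (finBelow T.F T.K u) hpw) dvd_rfl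

/-- Arithmetic glue: `l ∣ e`, `a·l ∣ e` and `15·l ∣ e·t` with `gcd(a, 15) = 1` give `15·a·l ∣ e·t`. [folklore] -/
private theorem fifteen_mul_mul_dvd_of_dvd {a l e t : ℕ} (hl : 0 < l) (hle : l ∣ e) (ha : a * l ∣ e)
    (h15 : 15 * l ∣ e * t) (hcop : Nat.Coprime a 15) : 15 * a * l ∣ e * t := by
  obtain ⟨e₁, rfl⟩ := hle
  -- cancel `l`
  have ha' : a ∣ e₁ := by
    have : l * a ∣ l * e₁ := by rw [mul_comm l a]; exact ha
    exact Nat.dvd_of_mul_dvd_mul_left hl this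
  have h15' : 15 ∣ e₁ * t := by
    have : l * 15 ∣ l * (e₁ * t) := by rw [mul_comm l 15, ← mul_assoc]; exact h15
    exact Nat.dvd_of_mul_dvd_mul_left hl this
  have hat : a ∣ e₁ * t := dvd_mul_of_dvd_left ha' t
  have h : a * 15 ∣ e₁ * t := hcop.mul_dvd_of_dvd_of_dvd hat h15'
  rw [show 15 * a * l = l * (a * 15) by ring, show l * e₁ * t = l * (e₁ * t) by ring]
  exact mul_dvd_mul_left l h

/-- **`30·l ∣ e(K_{x₀}/ℚ_3)·t` at every fibre point over `3` when `ord_3 j(q) = −2t`** (`t ≥ 1`, `l ≠ 3`): the Tate-root factor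
`15/gcd(15,t)` (abc-iut-W-neg-1's `GenuineK.fifteen_mul_prime_dvd_absRamificationIdx_kOf_mul_ratPoint`), the cyclotomic factor
`2 = 3 − 1` and the exact `l` — the R-W numerics lead's level-2 wild lower bound `lcm(15/gcd(15,t), 2)·l ∣ e` at `p = 3`.
[cite: SilvermanATAEC1994, V.5 Thm. 5.3 and Cor. 5.4] [cite: Washington1997, Prop. 2.1] [claim: Mochizuki2012, status: disputed] -/
theorem GenuineK.thirty_mul_prime_dvd_absRamificationIdx_kOf_mul_three {q : ℚ} {l : ℕ}
    (T : Cor22.ThetaVolumeDatumAt (ratPoint q) l) (hl3 : l ≠ 3) {t : ℕ} (ht : 0 < t)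
    (hpole : ∀ v : HeightOneSpectrum (𝓞 ℚ), Rat.HeightOneSpectrum.natGenerator v = 3 →
      Literature.IUT.LogVolume.ord ℚ v (Cor22.jInv q) = -(2 * (t : ℤ))) :
    letI := T.instFieldF; letI := T.instNumberFieldF; letI := T.instAlgebraF; letI := T.instFieldK
    letI := T.instNumberFieldK; letI := T.instAlgebraK; letI := T.instFieldFbar; letI := T.instAlgebraFbar
    letI := T.instAlgebraKFbar; letI := T.instIsElliptic
    haveI : Fact (3 : ℕ).Prime := ⟨Nat.prime_three⟩
    ∀ x₀ : (thetaIndex (pilotDataOfK T.D T.K)).Fibre (.inr ⟨3, Nat.prime_three⟩),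
      30 * l ∣ absRamificationIdx 3 (kOf (pilotDataOfK T.D T.K) 3 x₀) * t := by
  letI := T.instFieldF; letI := T.instNumberFieldF; letI := T.instAlgebraF; letI := T.instFieldK
  letI := T.instNumberFieldK; letI := T.instAlgebraK; letI := T.instFieldFbar; letI := T.instAlgebraFbar
  letI := T.instAlgebraKFbar; letI := T.instIsElliptic
  intro x₀
  have hpole' : ∀ v : HeightOneSpectrum (𝓞 ℚ), Rat.HeightOneSpectrum.natGenerator v = ((⟨3, Nat.prime_three⟩ : Nat.Primes) : ℕ) →
      Literature.IUT.LogVolume.ord ℚ v (Cor22.jInv q) < 0 := fun v hv => by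
    rw [hpole v hv]
    have : (0 : ℤ) < t := by exact_mod_cast ht
    linarith
  have hle := GenuineK.prime_dvd_absRamificationIdx_kOf_ratPoint T ⟨3, Nat.prime_three⟩ (by norm_num)
    (by simpa using hl3.symm) hpole' x₀
  have h2 := GenuineK.sub_one_mul_prime_dvd_absRamificationIdx_kOf_ratPoint T ⟨3, Nat.prime_three⟩ (by norm_num)
    (by norm_num) (by simpa using hl3.symm) hpole' x₀
  have h15 := GenuineK.fifteen_mul_prime_dvd_absRamificationIdx_kOf_mul_ratPoint T ⟨3, Nat.prime_three⟩ (by norm_num)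
    (by simpa using hl3.symm) ht hpole x₀
  have hl0 : 0 < l := T.D.l_prime.pos
  have h := fifteen_mul_mul_dvd_of_dvd (a := 2) hl0 hle h2 h15 (by norm_num)
  simpa [show (15 : ℕ) * 2 = 30 by norm_num] using h

/-- **`60·l ∣ e(K_{x₀}/ℚ_5)·t` at every fibre point over `5` when `ord_5 j(q) = −2t`** (`t ≥ 1`, `l ≠ 5`): the Tate-root factor
`15/gcd(15,t)`, the cyclotomic factor `4 = 5 − 1` (`ζ_5 ∈ F`) and the exact `l` — the R-W numerics lead's level-2 wild lower
bound `lcm(15/gcd(15,t), 4)·l ∣ e` at `p = 5`.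
[cite: SilvermanATAEC1994, V.5 Thm. 5.3 and Cor. 5.4] [cite: Washington1997, Prop. 2.1] [claim: Mochizuki2012, status: disputed] -/
theorem GenuineK.sixty_mul_prime_dvd_absRamificationIdx_kOf_mul_five {q : ℚ} {l : ℕ}
    (T : Cor22.ThetaVolumeDatumAt (ratPoint q) l) (hl5 : l ≠ 5) {t : ℕ} (ht : 0 < t)
    (hpole : ∀ v : HeightOneSpectrum (𝓞 ℚ), Rat.HeightOneSpectrum.natGenerator v = 5 →
      Literature.IUT.LogVolume.ord ℚ v (Cor22.jInv q) = -(2 * (t : ℤ))) :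
    letI := T.instFieldF; letI := T.instNumberFieldF; letI := T.instAlgebraF; letI := T.instFieldK
    letI := T.instNumberFieldK; letI := T.instAlgebraK; letI := T.instFieldFbar; letI := T.instAlgebraFbar
    letI := T.instAlgebraKFbar; letI := T.instIsElliptic
    haveI : Fact (5 : ℕ).Prime := ⟨Nat.prime_five⟩
    ∀ x₀ : (thetaIndex (pilotDataOfK T.D T.K)).Fibre (.inr ⟨5, Nat.prime_five⟩),
      60 * l ∣ absRamificationIdx 5 (kOf (pilotDataOfK T.D T.K) 5 x₀) * t := by
  letI := T.instFieldF; letI := T.instNumberFieldF; letI := T.instAlgebraF; letI := T.instFieldK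
  letI := T.instNumberFieldK; letI := T.instAlgebraK; letI := T.instFieldFbar; letI := T.instAlgebraFbar
  letI := T.instAlgebraKFbar; letI := T.instIsElliptic
  intro x₀
  have hpole' : ∀ v : HeightOneSpectrum (𝓞 ℚ), Rat.HeightOneSpectrum.natGenerator v = ((⟨5, Nat.prime_five⟩ : Nat.Primes) : ℕ) →
      Literature.IUT.LogVolume.ord ℚ v (Cor22.jInv q) < 0 := fun v hv => by
    rw [hpole v hv]
    have : (0 : ℤ) < t := by exact_mod_cast ht
    linarith
  have hle := GenuineK.prime_dvd_absRamificationIdx_kOf_ratPoint T ⟨5, Nat.prime_five⟩ (by norm_num)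
    (by simpa using hl5.symm) hpole' x₀
  have h4 := GenuineK.sub_one_mul_prime_dvd_absRamificationIdx_kOf_ratPoint T ⟨5, Nat.prime_five⟩ (by norm_num)
    (by norm_num) (by simpa using hl5.symm) hpole' x₀
  have h15 := GenuineK.fifteen_mul_prime_dvd_absRamificationIdx_kOf_mul_ratPoint T ⟨5, Nat.prime_five⟩ (by norm_num)
    (by simpa using hl5.symm) ht hpole x₀
  have hl0 : 0 < l := T.D.l_prime.pos
  have h := fifteen_mul_mul_dvd_of_dvd (a := 4) hl0 hle h4 h15 (by norm_num)
  simpa [show (15 : ℕ) * 4 = 60 by norm_num] using h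

/-- **Generic wild case over `3`** (`gcd(15, t) = 1`): `30·l ∣ e(K_{x₀}/ℚ_3)` — the numerics' exact lower type `e = l·e_W·r` with
`e_W·r ⊇ 2·15` at `p = 3` when `3 ∤ t`, `5 ∤ t`. [cite: SilvermanATAEC1994, V.5 Thm. 5.3 and Cor. 5.4] [claim: Mochizuki2012, status: disputed] -/
theorem GenuineK.thirty_mul_prime_dvd_absRamificationIdx_kOf_three_of_coprime {q : ℚ} {l : ℕ}
    (T : Cor22.ThetaVolumeDatumAt (ratPoint q) l) (hl3 : l ≠ 3) {t : ℕ} (ht : 0 < t) (hcop : Nat.Coprime 15 t)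
    (hpole : ∀ v : HeightOneSpectrum (𝓞 ℚ), Rat.HeightOneSpectrum.natGenerator v = 3 →
      Literature.IUT.LogVolume.ord ℚ v (Cor22.jInv q) = -(2 * (t : ℤ))) :
    letI := T.instFieldF; letI := T.instNumberFieldF; letI := T.instAlgebraF; letI := T.instFieldK
    letI := T.instNumberFieldK; letI := T.instAlgebraK; letI := T.instFieldFbar; letI := T.instAlgebraFbar
    letI := T.instAlgebraKFbar; letI := T.instIsElliptic
    haveI : Fact (3 : ℕ).Prime := ⟨Nat.prime_three⟩
    ∀ x₀ : (thetaIndex (pilotDataOfK T.D T.K)).Fibre (.inr ⟨3, Nat.prime_three⟩),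
      30 * l ∣ absRamificationIdx 3 (kOf (pilotDataOfK T.D T.K) 3 x₀) := by
  letI := T.instFieldF; letI := T.instNumberFieldF; letI := T.instAlgebraF; letI := T.instFieldK
  letI := T.instNumberFieldK; letI := T.instAlgebraK; letI := T.instFieldFbar; letI := T.instAlgebraFbar
  letI := T.instAlgebraKFbar; letI := T.instIsElliptic
  intro x₀
  have hpole' : ∀ v : HeightOneSpectrum (𝓞 ℚ), Rat.HeightOneSpectrum.natGenerator v = ((⟨3, Nat.prime_three⟩ : Nat.Primes) : ℕ) →
      Literature.IUT.LogVolume.ord ℚ v (Cor22.jInv q) < 0 := fun v hv => by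
    rw [hpole v hv]
    have : (0 : ℤ) < t := by exact_mod_cast ht
    linarith
  have h15 := GenuineK.fifteen_mul_prime_dvd_absRamificationIdx_kOf_ratPoint_of_coprime T ⟨3, Nat.prime_three⟩
    (by norm_num) (by simpa using hl3.symm) ht hcop hpole x₀
  have h2 := GenuineK.sub_one_mul_prime_dvd_absRamificationIdx_kOf_ratPoint T ⟨3, Nat.prime_three⟩ (by norm_num)
    (by norm_num) (by simpa using hl3.symm) hpole' x₀
  have hle := GenuineK.prime_dvd_absRamificationIdx_kOf_ratPoint T ⟨3, Nat.prime_three⟩ (by norm_num)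
    (by simpa using hl3.symm) hpole' x₀
  have hl0 : 0 < l := T.D.l_prime.pos
  have h' := fifteen_mul_mul_dvd_of_dvd (a := 2) (t := 1) hl0 hle h2 (by simpa using h15) (by norm_num)
  simpa [show (15 : ℕ) * 2 = 30 by norm_num] using h'

/-- **Generic wild case over `5`** (`gcd(15, t) = 1`): `60·l ∣ e(K_{x₀}/ℚ_5)`.
[cite: SilvermanATAEC1994, V.5 Thm. 5.3 and Cor. 5.4] [cite: Washington1997, Prop. 2.1] [claim: Mochizuki2012, status: disputed] -/
theorem GenuineK.sixty_mul_prime_dvd_absRamificationIdx_kOf_five_of_coprime {q : ℚ} {l : ℕ}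
    (T : Cor22.ThetaVolumeDatumAt (ratPoint q) l) (hl5 : l ≠ 5) {t : ℕ} (ht : 0 < t) (hcop : Nat.Coprime 15 t)
    (hpole : ∀ v : HeightOneSpectrum (𝓞 ℚ), Rat.HeightOneSpectrum.natGenerator v = 5 →
      Literature.IUT.LogVolume.ord ℚ v (Cor22.jInv q) = -(2 * (t : ℤ))) :
    letI := T.instFieldF; letI := T.instNumberFieldF; letI := T.instAlgebraF; letI := T.instFieldK
    letI := T.instNumberFieldK; letI := T.instAlgebraK; letI := T.instFieldFbar; letI := T.instAlgebraFbar
    letI := T.instAlgebraKFbar; letI := T.instIsElliptic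
    haveI : Fact (5 : ℕ).Prime := ⟨Nat.prime_five⟩
    ∀ x₀ : (thetaIndex (pilotDataOfK T.D T.K)).Fibre (.inr ⟨5, Nat.prime_five⟩),
      60 * l ∣ absRamificationIdx 5 (kOf (pilotDataOfK T.D T.K) 5 x₀) := by
  letI := T.instFieldF; letI := T.instNumberFieldF; letI := T.instAlgebraF; letI := T.instFieldK
  letI := T.instNumberFieldK; letI := T.instAlgebraK; letI := T.instFieldFbar; letI := T.instAlgebraFbar
  letI := T.instAlgebraKFbar; letI := T.instIsElliptic
  intro x₀
  have hpole' : ∀ v : HeightOneSpectrum (𝓞 ℚ), Rat.HeightOneSpectrum.natGenerator v = ((⟨5, Nat.prime_five⟩ : Nat.Primes) : ℕ) →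
      Literature.IUT.LogVolume.ord ℚ v (Cor22.jInv q) < 0 := fun v hv => by
    rw [hpole v hv]
    have : (0 : ℤ) < t := by exact_mod_cast ht
    linarith
  have h15 := GenuineK.fifteen_mul_prime_dvd_absRamificationIdx_kOf_ratPoint_of_coprime T ⟨5, Nat.prime_five⟩
    (by norm_num) (by simpa using hl5.symm) ht hcop hpole x₀
  have h4 := GenuineK.sub_one_mul_prime_dvd_absRamificationIdx_kOf_ratPoint T ⟨5, Nat.prime_five⟩ (by norm_num)
    (by norm_num) (by simpa using hl5.symm) hpole' x₀
  have hle := GenuineK.prime_dvd_absRamificationIdx_kOf_ratPoint T ⟨5, Nat.prime_five⟩ (by norm_num)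
    (by simpa using hl5.symm) hpole' x₀
  have hl0 : 0 < l := T.D.l_prime.pos
  have h' := fifteen_mul_mul_dvd_of_dvd (a := 4) (t := 1) hl0 hle h4 (by simpa using h15) (by norm_num)
  simpa [show (15 : ℕ) * 4 = 60 by norm_num] using h'

end Summit.ABC.IUTFork.Conditional

end
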